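import Summits.QuantumFields.YangMills.Theorems.BalabanUVNodesN12AtRecord13Prop1KnitThm1WindowDirectOfClassOnlyRowL1NearRadiusDatumScaleAtLengthOfRecordB
import Summits.QuantumFields.YangMills.Theorems.BalabanUVNodesN12MinimiserFamilyKnitRowThm1LettersAtLengthOnZOfRecordB
import Summits.QuantumFields.YangMills.Theorems.BalabanUVNodesN12Thm1LettersAtLengthOfK0GridGB
import Literature.MathematicalPhysics.QuantumFieldTheory.Balaban1983to89.B11Thm1ExistsUniqueTokensGB
import Literature.MathematicalPhysics.QuantumFieldTheory.Balaban1983to89.B15Prop1MinimiserClassAtDatumScaleAtLengthB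
import Summits.QuantumFields.YangMills.Theorems.BalabanUVNodesN12Prop1DirectOfClassOnlyRowL1UniformBLam
import Summits.QuantumFields.YangMills.Theorems.BalabanUVNodesN12Prop1DirectOfClassOnlyB
import Summits.QuantumFields.YangMills.Theorems.BalabanUVNodesN12DirectChartPackageOfClassRowL1FamilyB
import Literature.MathematicalPhysics.QuantumFieldTheory.Balaban1983to89.Node00.MultiScaleFibreChartB
import Literature.MathematicalPhysics.QuantumFieldTheory.Balaban1983to89.B15Sect1InstancesB
import Literature.MathematicalPhysics.QuantumFieldTheory.Balaban1983to89.Node00.LargeFieldBackgroundCoPOfRecordB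
import Literature.MathematicalPhysics.QuantumFieldTheory.Balaban1983to89.Node00.CriticalOnFibreTopGuardedB
import Summits.QuantumFields.YangMills.Theorems.BalabanUVNodesN12Thm1LetterAtLengthLamDatumInhabited
import HarnessLib

/-!
# BalabanUVNodes ∕ N12 — AT K0⁷'s STUB 1 (V23ᴮ, `K0Stub1BHolds`): THE (8) NAME DISCHARGED — — «12Q-DIRECT v14ᴸ»: THE JUNCTION OF RECORD v14 ✓p751583 (letters discharged) KEYED ON THE GUARD-GENERIC [15]-THEOREM-1 NAMES, letters read AT LENGTH inside — **BOND-DATUM EDITION** (`…N12AtRecord13Prop1KnitThm1WindowDirectDatumScaleLettersDischargedAtLengthOfThm1NamedFactsGOfRecordB`, USED DECLARATIONS ONLY)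

The print-datum ([Balaban1984PropagatorsII] (2.3)) (γ) twin of `Summits/…/Theorems/BalabanUVNodesN12AtRecord13Prop1KnitThm1WindowDirectDatumScaleLettersDischargedAtLengthOfThm1NamedFactsGOfRecord.lean`: the declarations of the parent whose STATEMENT reads the determining datum
(`exists_constants_thresholds_radius_areg_pinLF_b15Leaf_WOfRecord₁₃_liveRepin₁₃_windowDirectDatumScale_lettersDischargedAtLength_ofThm1NamedFactsG`) and which N12's junction of record v14ᴸ uses (dag-n12-c g35 probe-2 census `UsedConstsN12RoadTyped2`, THEOREMS block), re-typed over a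
BOND-LEVEL datum `𝔅 : BDetSet` (F0a `B15DeterminingSetsB`) and dag-n12-c's bond-datum chart `Node00.msChartB` (✓p774329; `msChart 𝐁 = msChartB (bondsDet 𝐁)` by `rfl`).  GENERATOR twin
(this seat's `work/g32/gen_thm.py`, block-extracted from the parent's tree bytes): namespace `…N12AtRecord13Prop1KnitThm1WindowDirectDatumScaleLettersDischargedAtLengthOfThm1NamedFactsGOfRecordB`, SAME short names, `DetSet ↦ BDetSet`, `AgreeOn 𝐁 ↦ AgreeOnB 𝔅`,
`IsMinimizer ↦ IsMinimizerB`, `bondsOf (𝐁 j) ↦ 𝔅 j`, `msChart ∕ constrCard ∕ constrEnum ∕ ConstrSet ↦ …B`, NODE 00 chart lemmas `…msChart… ↦ …msChartB…`; proofs VERBATIM; the parent's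
datum-free declarations REUSED BY NAME (`open`), never copied (private plumbing excepted, №366 R2).  The parent's (b) statements are the instances `𝔅 := bondsDet 𝐁`.
v14ᴸᴮ — THE JUNCTION OF RECORD OF N12`s 12Q-DIRECT ROAD AT PRINT`s [II] (2.3) DATUM, KEYED ON THE GB [15]-THEOREM-1 NAMES: `h15 : VariationalThm1RegSepCoP7MGB F 2 Adm (lamDatum F) (dataSmall7PTopOf F 2) B₃ a₀ a₁`` ` (K0⁷`s post-seam (8)-currency type, guard-generic `Adm`) and `h15EU : B11Thm1ExistsUniqueTokensGB.VariationalThm1EUSepCoP7MGB F 2 Adm (lamDatum F) (dataSmall7PTopOf F 2) B₃ a₀ a₁`` `; the at-length letters by this seat`s 113 ✓p774410 (`thm1LetterT_atLength_of_variationalThm1RegSepCoP7MGB`, `thm1LetterEU_atLength_of_variationalThm1EUSepCoP7MGB`); the T4′ᴸ socket = 167 (12Q-OfRecordᴮ), the knit row = 166, the chart-half ∕ (P4)′ ∕ curvature families = 150 ∕ 155 ∕ 129, the class kit = n12-c`s `B15Prop1MinimiserClassAtDatumScaleAtLengthB`; conclusion = N12`s `B15Leaf (WOfRecord₁₃ …)`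 with the LF layer at `InstOn.stdB (bgMSCoPOfRecordB …) Θ.ν.M₁ lamDatumP`. THIS FILE DOES NOT IMPORT ITS (b) PARENT (whose closure sits on the §RESIDUE modules `…K0{R,SignFree,AllTorus}OfStepTokensRCube` ∕ `…Guarded` through ζ → `K0V22ZDefs`); every import is green on both sides of the seam.
Cell `pub-ymgap` (HUMAN RULINGS D-0062 ∕ D-0149), seat `pub-ymgap-dag-n12-d` g32 (R134 N12 [B15] s2; the (ii) Theorems-side re-key of N12's road at print's [II] (2.3) datum — director-ym №338 ∕
№343 (E1)(iii-b), FLAG №16 ∕ ruling (α); dag-n12-c DESIGN memo a793b2ebc0b803bf (ii); `N12-ROAD-TWIN-ORDER-2026-08-30.md`).  Count-neutral helper of K1⁹ `stmt-QuantumFields-27364`,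
`--kind proof --supports … --as helper`.  THEOREMS ONLY (0 `def`, 0 `instance`, 0 `sorry`).

HONEST FRAMING (director-ym №338 (5)).  PURELY ADDITIVE: the parent stays landed and true on its own text; nothing in it is edited; no displayed premise of any consumer is deleted or
weakened; every hypothesis of the parent stays a hypothesis.  Nothing of Bałaban's analysis asserted; N12 NOT discharged; K0⁷ ∕ K1⁹ NOT closed; counts unmoved (typed 28∕28 · discharged
8∕27, A 8∕28; K 1∕4); one finite 𝕋⁴ programme at fixed ε — R4 closes the conditional rung `BalabanLadder.UV` only; NOT the Yang–Mills mass gap (Clay); nothing continuum ∕ ℝ⁴ ∕ OS.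

PARENT's DOCSTRING (the mathematics and the citations; read the site-level `𝐁` as the bond datum `𝔅`):
(see the parent module — not reproduced here, 400-line lint; the citations of every declaration below are carried in its own docstring)
-/

noncomputable section
open MeasureTheory Set Finset Metric Filter
open scoped Matrix.Norms.L2Operator BigOperators Matrix RealInnerProductSpace Real InnerProductSpace Topology

namespace Summit.QuantumFields.YangMills.BalabanUVNodes.N12AtRecord13Prop1KnitThm1WindowDirectDatumScaleLettersDischargedAtLengthOfK0Stub1BOfRecord

open Literature.MathematicalPhysics.QuantumFieldTheory.Balaban1983to89.B15DeterminingSetsB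

open Literature.MathematicalPhysics.QuantumFieldTheory.Balaban1983to89
open Literature.MathematicalPhysics.QuantumFieldTheory.Balaban1983to89.T4Continuum (T4Family LStep Letter walk walkEnd netDisp holAt)
open Literature.MathematicalPhysics.QuantumFieldTheory.Balaban1983to89.DagBinding
open Literature.MathematicalPhysics.QuantumFieldTheory.Balaban1983to89.Node00
open FlowStep (prefixOf BetaLowerH BetaUpperH)
open B15Claim189Assembly (new189 chiPP dom half)
open B15 (Prop1Printed Ineq180)
open B15.BasicStep (Claim189)
open B8Eq17ClassAkV1 (plaqsOf)
open B14.Eq216Concrete (inputs feeds)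
open GaugeGroup (dist1)
open GaugeField (plaqHol gaugeAct)
open B15RPrime1100OfRep (rPrimeDataOfSel)
open Summit.QuantumFields.YangMills.BalabanUVNodes.N12AtRecord13OfResiduals (b15Leaf_WOfRecord₁₃_liveRepin₁₃_of_massLive_of_hasResiduals)
open T4CubeChartGnomonic (SU2)
open B15Prop1ChartSU2 (su2Chart)
open B15Prop1SliceCoordinates (GaugeSlice ιA)
open T4AxialGaugeSmallField (castSite boxPlaqs boxBonds)
open B6BondElimination (unitVec)
open B6TreeGaugePoincare (curl)
open B16Eq18Proof (box)
open B15Extension193 (extend)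
open B15ShellGauge193 (shellGauge)
open B15Sect1Instances (fun177stdB)
open B14.Eq213DetSet (Bj maxDomT)
open B14.Eq213MaximalDomains (side)
open B14.Eq22Determines (blockIter IsBlockUnion)
open Literature.MathematicalPhysics.QuantumFieldTheory.BalabanImbrieJaffe1984to88.BIJ85Eq453GaugeField (qsstarGIter0)
open B16Sect1Backgrounds (expMul toMS)
open B15DeterminingSets (pts DetBackground genSet IsMinimizer MSField avgFamily bondsOf DetSet embIter AgreeOn)
open B5Eq118OneStroke (iterBlockOf)
open Literature.MathematicalPhysics.QuantumFieldTheory.Balaban1983to89.Node00 (coeField constrEnumB)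
open B15Eq112TorusCover (lift)
open ExpMeanLog (deltaSU)
open B15Prop1Carrier (lfVarOn InstOn InstOn.std InstOn.stdB plaqsInside)
open Summit.QuantumFields.YangMills.BalabanUVNodes.N12AtRecord13Prop1KnitThm1WindowDirectOfClassOnlyRowL1NearRadiusDatumScaleAtLengthOfRecordB (exists_areg_pinLF_b15Leaf_WOfRecord₁₃_liveRepin₁₃_of_massLive_of_hasResiduals_of_thm1AtLength_atZSeqCoPRecord_windowDirectOfClassOnlyRowL1NearRadiusDatumScale)
open Summit.QuantumFields.YangMills.BalabanUVNodes.N12MinimiserFamilyKnitRowThm1LettersAtLengthOnZOfRecordB (exists_R_hMinRow_of_thm1LettersAtLength_alongOrbit_onZ_ofRecord)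
open Summit.QuantumFields.YangMills.BalabanUVNodes.N12Thm1LetterAtLengthLamDatumInhabited (exists_thm1LetterT_atLength_lamDatum_pTop_inhabited)
open B15Prop1NumericsThresholds (plaqSmallOn_of_le)
open B15Prop1MinimiserClassAtDatumScaleAtLengthB (isMinimizerB_withEps_base_of_thm1AtLength isMinimizerB_withEps_of_norm_lt_atLength lamBondsSeq_congr)
open Summit.QuantumFields.YangMills.BalabanUVNodes.N12DirectChartPackageOfClassRowL1FamilyB (exists_hWD_chartHalf_of_class_uniform_rowl1_family)
open Summit.QuantumFields.YangMills.BalabanUVNodes.N12Prop1DirectOfClassOnlyRowL1UniformBLam (exists_rowPreimageProxiesLetter_family_uniformB_lamBondsSeq)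
open Summit.QuantumFields.YangMills.BalabanUVNodes.N12Prop1DirectOfClassOnlyB (exists_curvatureLetters_family)
open Summit.QuantumFields.YangMills.BalabanUVNodes.N12MinimiserFamilyKnitRowThm1Letters (boxRow3_of_boxRow5)
open T4AdjointCovarianceUnitary (lieSU)
open B15Prop1GradientFromNearValueAtCoPRecord (far_letter_of_box)
open B15Prop1AnalyticExtClause (cplxVec anExt)
open B15Prop1ChartCalculusSU2 (E3)
open B15Sect1Instances (lamDatumP)
open B11Thm1ExistsUniqueTokensGB (VariationalThm1EUSepCoP7MGB)
open Summit.QuantumFields.YangMills.BalabanUVNodes.N12Thm1LettersAtLengthOfK0GridGB (thm1LetterEU_atLength_of_variationalThm1EUSepCoP7MGB)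

section
variable {F : T4Family}

/-- ★★★★★ **«12Q-DIRECT v14ᴸ» — THE JUNCTION OF RECORD v14 ✓p751583 KEYED ON THE GUARD-GENERIC [15]-THEOREM-1 NAMES (`Adm : StepGuard F`, one guard row `hadm₀` at `ν₀`; the K0 road's
registered currency = `Adm := A‴`), letters read AT LENGTH inside; the four letter families discharged and their nine constants announced ∃-first as in v14**: ∃ thresholds `ρJ εW δ₀` (head ✓p740879 at `ν₀`) and letter constants `C ρ Kτ ρτ ρ5 εH B₁ ρ6 M₂` (uniform producers, functions of `(P.K, k)`) → ∀ `Θ` pinned to `ν₀`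
off `εreg` → T4′'s `Θ`-rows (minus the two letter families) → ∀ guard cap `eG` with the head's rows → ∃ radius `R` → ∀ data budget `eR ≤ eG` with the floor rows (on announced `ρ5`, `ρ6`) →
∀ tolerance `δ` in the window → `∃ areg`, N12's Prop-1 leaf at the live re-pin.  Proof: ✓p748139's, plus `exists_hWD_chartHalf_of_class_uniform_rowl1_family` ∕
`exists_rowPreimageProxiesLetter_family_uniformB_lamBondsSeq` ∕ `exists_curvatureLetters_family` per run.  Count-neutral; CONDITIONAL; NOT a discharge of N12.
[cite: Balaban1989LargeFieldI, (0.2)–(0.6) p.176, (1.74) p.192, p.193 ll.14–20, Prop. 1 (1.77)–(1.78) p.194; Balaban1985Variational, (1) p.277, (2)–(7) p.278, Thm 1 (8) p.279, (44)–(47) p.285, (83) p.290, Sect. G pp.305–307; Balaban1989LargeFieldII, (1.7)–(1.9) p.358, (1.12)–(1.13) p.359; Balaban1988Convergent, (2.2) p.255, (2.10)–(2.13) pp.256–257] -/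
theorem exists_constants_thresholds_radius_areg_pinLF_b15Leaf_WOfRecord₁₃_liveRepin₁₃_windowDirectDatumScale_lettersDischargedAtLength_ofK0Stub1B_ofThm1EUNameGB
    (hd3 : ∀ P : B12.RunParams, 3 ≤ (F.P P.K).d)
    (h0 : ∀ P : B12.RunParams, 0 < (F.P P.K).d)
    (ι : B12.RunParams → Type)
    (Z Λ : ∀ P : B12.RunParams, ι P → Set (Site (F.P P.K) 0))
    (k : ∀ P : B12.RunParams, ι P → ℕ)
    (M : ∀ P : B12.RunParams, ι P → ℝ)
    (hk0 : ∀ (P : B12.RunParams) (i : ι P), 0 < k P i)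
    (hk1 : ∀ (P : B12.RunParams) (i : ι P), k P i + 1 ≤ (F.P P.K).m + (F.P P.K).K)
    (T : ∀ (P : B12.RunParams) (i : ι P), Finset (PBond (F.P P.K) (k P i)))
    (lo hi : ∀ P : B12.RunParams, ι P → Fin (F.P P.K).d → ℤ)
    (n : ∀ P : B12.RunParams, ι P → ℕ)
    (hn : ∀ (P : B12.RunParams) (i : ι P) κ, hi P i κ ≤ lo P i κ + n P i)
    (hN : ∀ (P : B12.RunParams) (i : ι P), n P i + 2 < (F.P P.K).sitesPerDir (k P i))
    (hbox : ∀ (P : B12.RunParams) (i : ι P), pts (k P i) (Λ P i) = (castSite '' Set.Icc (lo P i) (hi P i) : Set (Site (F.P P.K) (k P i))))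
    (hZ : ∀ (P : B12.RunParams) (i : ι P), (boxPlaqs (lo P i - 1) (hi P i + 1) : Set (Plaq (F.P P.K) (k P i))) ⊆ plaqsInside (pts (k P i) (Z P i)))
    (hTG0 : ∀ (P : B12.RunParams) (i : ι P), T P i = (box (fun κ => (hi P i κ - lo P i κ + 1).toNat) (lo P i)).image fun x =>
      (⟨castSite (x - unitVec ⟨0, h0 P⟩), ⟨0, h0 P⟩⟩ : PBond (F.P P.K) (k P i)))
    (hN5 : ∀ (P : B12.RunParams) (i : ι P) κ, ((hi P i κ - lo P i κ + 1).toNat : ℤ) + 5 < (F.P P.K).sitesPerDir (k P i))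
    (Kb : ∀ P : B12.RunParams, ι P → ℕ)
    (hK1 : ∀ (P : B12.RunParams) (i : ι P), 1 ≤ Kb P i)
    (hKn : ∀ (P : B12.RunParams) (i : ι P) κ, (hi P i κ - lo P i κ + 1).toNat ≤ Kb P i)
    (ext : ∀ (P : B12.RunParams) (i : ι P), GaugeField (F.P P.K) (k P i) SU2 → GaugeField (F.P P.K) (k P i) SU2)
    (hext : ∀ (P : B12.RunParams) (i : ι P) Vk, ext P i Vk = extend (pts (k P i) (Λ P i)) (shellGauge Vk (lo P i) (hi P i)) Vk)
    (hlohi : ∀ (P : B12.RunParams) (i : ι P), lo P i ≤ hi P i)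
    (LO HI : ∀ P : B12.RunParams, ι P → Fin (F.P P.K).d → ℤ)
    (hLO : ∀ (P : B12.RunParams) (i : ι P), LO P i ≤ lo P i - 1)
    (hHI : ∀ (P : B12.RunParams) (i : ι P), hi P i + 1 ≤ HI P i)
    (n' : ∀ P : B12.RunParams, ι P → ℕ)
    (hn' : ∀ (P : B12.RunParams) (i : ι P) κ, HI P i κ ≤ LO P i κ + n' P i)
    (hn'N : ∀ (P : B12.RunParams) (i : ι P), n' P i < (F.P P.K).sitesPerDir (k P i))
    (hR' : ∀ (P : B12.RunParams) (i : ι P), (boxPlaqs (LO P i) (HI P i) : Set (Plaq (F.P P.K) (k P i))) ⊆ plaqsInside (pts (k P i) (Z P i)))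
    {γ₈ bx : B12.RunParams → ℝ}
    (hγ : ∀ P : B12.RunParams, 0 < γ₈ P)
    (hbx : ∀ P : B12.RunParams, 0 ≤ bx P)
    (hbxM : ∀ (P : B12.RunParams) (i : ι P), 12 * ((F.P P.K).d : ℝ) * ((n P i : ℝ) + 2) ^ 2 ≤ bx P * (M P i) ^ 2)
    (hM : ∀ (P : B12.RunParams) (i : ι P), 1 ≤ (M P i))
    (W : ∀ P : B12.RunParams, ι P → Finset (Plaq (F.P P.K) 0))
    (hWbox : ∀ (P : B12.RunParams) (i : ι P), ∀ q : Plaq (F.P P.K) 0, q.src ∈ ((box (fun κ => (F.P P.K).L ^ (k P i) * ((hi P i κ - lo P i κ + 1).toNat + 3 + 1) - 1) (fun κ => ((F.P P.K).L : ℤ) ^ (k P i) * (lo P i κ - 2))).image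
        (fun z => (castSite z : Site (F.P P.K) 0))) → q ∈ W P i)
    (c : ∀ P : B12.RunParams, ι P → ℕ)
    (hkc : ∀ (P : B12.RunParams) (i : ι P), k P i + c P i ≤ (F.P P.K).m + (F.P P.K).K)
    (hc : ∀ (P : B12.RunParams) (i : ι P), 4 * (F.P P.K).d + (3 * ((F.P P.K).d * (((F.P P.K).L - 1) / 2)) + 5) + 3 < 2 * (F.P P.K).L ^ c P i)
    (X : ∀ P : B12.RunParams, ι P → Set (Site (F.P P.K) 0))
    (D₀ : ∀ P : B12.RunParams, ι P → ℕ)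
    (hBox : ∀ (P : B12.RunParams) (i : ι P), ∀ x ∈ X P i, ∀ w : List (Letter (F.P P.K).d),
      w.length ≤ (∑ i' ∈ Finset.range (k P i + 1), ((F.P P.K).d * (((F.P P.K).L ^ i' - 1) / 2) + 1)) + (3 * ((F.P P.K).d * (((F.P P.K).L - 1) / 2)) + 5) * (F.P P.K).L ^ k P i + (F.P P.K).L ^ k P i →
      ∀ μ : Fin (F.P P.K).d, (⟨B14.Eq22Determines.blockIter (k P i) (walkEnd x w), μ⟩ : PBond (F.P P.K) (k P i)) ∈ (boxBonds (LO P i) (HI P i) : Set (PBond (F.P P.K) (k P i))))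
    (hWX : ∀ (P : B12.RunParams) (i : ι P), ∀ p ∈ W P i, p.src ∈ X P i ∧ p.src.shift p.μ ∈ X P i ∧ p.src.shift p.ν ∈ X P i ∧ (p.src.shift p.μ).shift p.ν ∈ X P i ∧ (p.src.shift p.ν).shift p.μ ∈ X P i)
    (hfeedsX : ∀ (P : B12.RunParams) (i : ι P) (ν' : Fin (F.P P.K).d), ∀ z ∈ box (fun κ => (hi P i κ - lo P i κ + 1).toNat + 3) (fun κ => lo P i κ - 2), ∀ b₀ : PBond (F.P P.K) 0,
      (b₀ ∈ feeds (k P i) (⟨(castSite z : Site (F.P P.K) (k P i)), ⟨0, h0 P⟩⟩ : PBond (F.P P.K) (k P i)) ∨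
        b₀ ∈ feeds (k P i) (⟨((castSite z : Site (F.P P.K) (k P i))).shift ⟨0, h0 P⟩, ν'⟩ : PBond (F.P P.K) (k P i)) ∨
        b₀ ∈ feeds (k P i) (⟨((castSite z : Site (F.P P.K) (k P i))).shift ν', ⟨0, h0 P⟩⟩ : PBond (F.P P.K) (k P i)) ∨
        b₀ ∈ feeds (k P i) (⟨(castSite z : Site (F.P P.K) (k P i)), ν'⟩ : PBond (F.P P.K) (k P i))) → b₀.src ∈ X P i ∧ b₀.tgt ∈ X P i)
    {cE cA : B12.RunParams → ℝ}
    (hcE0 : ∀ P : B12.RunParams, 0 ≤ cE P)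
    (hcE : ∀ (P : B12.RunParams) (i : ι P), 12 * ((F.P P.K).d : ℝ) * ((n P i : ℝ) + 2) ^ 2 ≤ cE P)
    (hγle : ∀ (P : B12.RunParams) (i : ι P), γ₈ P / (M P i) ^ 5 ≤ 1 / 2 / (2 * (3 * (Kb P i : ℝ) ^ 2 + 2 * (Kb P i : ℝ) ^ 4)))
    (hZblk : ∀ (P : B12.RunParams) (i : ι P), IsBlockUnion (k P i) (Z P i))
    -- [15] THEOREM 1 (8), GUARD-GENERIC NAMED FACT in K0⁷'s house (`Adm : StepGuard F`; at `Adm := A‴` = the K0 road's REGISTERED currency via `variationalThm1RegSepCoP7MG_of_prop8TopStepG`)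
    (Adm : Node00.StepGuard F)
    -- THE (J0′) HEAD's SKELETON ROWS AT εreg-BLIND NUMERICS `ν₀` (the head of record ✓p740879 is instantiated at `ν₀`; `Θ.ν` is pinned to `ν₀` off the class threshold below)
    (ν₀ : Node00.Stage7Numerics)
    (hdiv₀ : ∀ (P : B12.RunParams) (i : ι P), side (F.P P.K).L ν₀.M₁ (k P i) ∣ (F.P P.K).sitesPerDir 0)
    (hfloor₀ : ∀ P : B12.RunParams, ((F.P P.K).d + 14) * (F.P P.K).L ≤ ν₀.M₁)
    (hMrad₀ : ∀ P : B12.RunParams, (4 * (F.P P.K).d + (3 * ((F.P P.K).d * (((F.P P.K).L - 1) / 2)) + 5)) * (F.P P.K).L ^ 2 + 2 * (F.P P.K).d * (F.P P.K).L + 12 ≤ ν₀.M₁)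
    (hM₁₀ : ∀ P : B12.RunParams, (((F.P P.K).d + 4) * (F.P P.K).L + 6) * (F.P P.K).L ^ 2 ≤ ν₀.M₁)
    -- THE GUARD ROW at the head's εreg-blind numerics `ν₀`, per instance, along the degenerate history `(M, g) := (ν₀.M₁, 1)` (β's `hadm`; at `A‴`: `c ≤ ν₀.M₁`, `k P i + c₀ ≤ m + K`, `L^{c₁} ∣ ν₀.M₁`)
    (hadm₀ : ∀ (P : B12.RunParams) (i : ι P) (s₁ : SeqOfRecord F ν₀ ν₀.M₁ (fun _ => (1 : ℝ)) P.K (k P i)), Adm ν₀ ν₀.M₁ (fun _ => (1 : ℝ)) P.K (k P i) s₁)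
    -- the BOX SCOPE row of the head (every `k`-bond inside `Z^{(k)}` is a bond of the region box)
    (hscope : ∀ (P : B12.RunParams) (i : ι P), {e : PBond (F.P P.K) (k P i) | e.src ∈ pts (k P i) (Z P i) ∧ e.tgt ∈ pts (k P i) (Z P i)} ⊆ boxBonds (LO P i) (HI P i))
    -- the analytic family's bound scale (`𝓐₀ P i := 4·𝓐₁`)
    (𝓐₁ : ℝ) (h𝓐₁ : 1 < 𝓐₁)
    -- [15] THEOREM 1, EXISTENCE ∕ UNIQUENESS — the lane's GUARD-GENERIC NAMED fact (dag-n12-c g30 ✓p742279); «INHABITED BY»: OPEN (no producer; N07 ∕ NODE-00 obligation)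
    :
    -- K0⁷'s STUB 1 (V23ᴮ) BY NAME: its OWN constants `(cK, c₀K, c₁K; B₃, a₀, a₁')` with `2L² ≤ B₃`, `0 < a₀`, `0 < a₁'` (this seat's 114 ✓p774580 `exists_thm1LetterT_atLength_lamDatum_pTop_inhabited`,
    -- from `K0Stub1BHolds.prop8StepCoPGridGBAt_holds`); UNDER them: the stub's three numeric rows per instance (grid guard `A‴`: `cK ≤ ν₀.M₁`, `k P i + c₀K ≤ m + K`, `L^{c₁K} ∣ ν₀.M₁`) and
    -- [15] THEOREM 1 (E∕U) as the GB NAME at THOSE constants (`Adm`-generic; «INHABITED BY»: OPEN — no producer, orphan edge N07→N12)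
    ∃ (cK c₀K c₁K : ℕ) (B₃ a₀ a₁' : ℝ), 2 * (F.L : ℝ) ^ 2 ≤ B₃ ∧ 0 < a₀ ∧ 0 < a₁' ∧
    ((∀ (P : B12.RunParams) (i : ι P), cK ≤ ν₀.M₁ ∧ k P i + c₀K ≤ F.m + P.K ∧ F.L ^ c₁K ∣ ν₀.M₁) →
    VariationalThm1EUSepCoP7MGB F 2 Adm (lamDatum F) (dataSmall7PTopOf F 2) B₃ a₀ a₁' →
    -- THE THREE THRESHOLDS of the (J0′) head, announced from (ν₀, P.K, Z P i, k P i, the two [15] names) BEFORE Θ ∕ the class threshold ∕ the data budget (U4-existential, instance-dependent)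
    ∃ ρJ εW δ₀ : ∀ P : B12.RunParams, ι P → ℝ, (∀ P i, 0 < ρJ P i) ∧ (∀ P i, 0 < εW P i) ∧ (∀ P i, 0 < δ₀ P i) ∧
    -- THE NINE LETTER CONSTANTS of the chart half (`C ρ Kτ ρτ ρ5`), the (P4)′ row (`εH B₁`), the small-below ∕ curvature letters (`ρ6 M₂`) — functions of `(P.K, k P)`, from the uniform producers
    ∃ C ρ Kτ ρτ ρ5 εH B₁ ρ6 M₂ : ∀ P : B12.RunParams, ι P → ℝ, (∀ P i, 0 ≤ C P i) ∧ (∀ P i, 0 < ρ P i) ∧ (∀ P i, 0 ≤ Kτ P i) ∧ (∀ P i, 0 < ρτ P i) ∧ (∀ P i, 0 < ρ5 P i) ∧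
      (∀ P i, 0 < εH P i) ∧ (∀ P i, 0 ≤ B₁ P i) ∧ (∀ P i, 0 < ρ6 P i) ∧ (∀ P i, 0 ≤ M₂ P i) ∧
    ∀ (Θ : Stage13Params F 2) (lam : ResidW F 2), { ν₀ with εreg := Θ.ν.εreg } = Θ.ν →
      (Θ.HasResidualsOfRecord F 2) →
      (∀ P : B12.RunParams, lam.kSel P < P.K → lam.D1100 P
      = rPrimeDataOfSel (reprTOfRecord₁₃ F 2 (Θ.liveRepin₁₃ F 2) P (lam.kSel P))
          ((Θ.liveRepin₁₃ F 2).ppSel P (gOfRecord₁₃ F 2 (Θ.liveRepin₁₃ F 2) P) (lam.kSel P + 1))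
          (fibOfSeq F (Θ.liveRepin₁₃ F 2).ν (Θ.liveRepin₁₃ F 2).τ9 P (gOfRecord₁₃ F 2 (Θ.liveRepin₁₃ F 2) P) (lam.kSel P + 1))) →
      (∀ P : B12.RunParams, lam.kSel P < P.K → ∀ s, LiveSeq F 2 Θ.ν Θ.τ9 P (gOfRecord₁₃ F 2 (Θ.liveRepin₁₃ F 2) P) (lam.kSel P + 1)
        (slotsTOfRecord F 2 Θ.ν Θ.τ9 (EOfRecord₁₃ F 2 (Θ.liveRepin₁₃ F 2)) (wOfRecord₉ F 2 (Θ.liveRepin₁₃ F 2).toStage9Params)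
          (Θ.liveRepin₁₃ F 2).ppSel P (gOfRecord₁₃ F 2 (Θ.liveRepin₁₃ F 2) P) (lam.kSel P + 1)) s →
      0 < ∫ V, rterm (reprTOfRecord₁₃ F 2 (Θ.liveRepin₁₃ F 2) P (lam.kSel P)) s V ∂(fieldMeasure (F.P P.K) (lam.kSel P + 1) (SU 2))) →
      (∀ P : B12.RunParams, lam.kSel P < P.K → ∀ U, new189 (lam.D189 P) U → ∀ i, (lam.D189 P).h ≤ i → i ≤ (lam.D189 P).k →
      ∀ q ∈ plaqsOf (dom (lam.D189 P) i),
        Ineq180 ((lam.D189 P).dev0 U q) ((lam.D189 P).ε (lam.D189 P).k) (lam.D189 P).η (lam.D189 P).B₃ (lam.D189 P).B₅ (lam.D189 P).M (lam.D189 P).δ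
          ((lam.D189 P).dist q) (lam.D189 P).O1) →
      (∀ P : B12.RunParams, lam.kSel P < P.K → Claim189 (new189 (lam.D189 P)) (chiPP (lam.D189 P))) →
      (∀ (P : B12.RunParams) (i : ι P), ∀ (ν' : Fin (F.P P.K).d), ∀ z ∈ box (fun κ => (hi P i κ - lo P i κ + 1).toNat + 3) (fun κ => lo P i κ - 2),
      (castSite z : Site (F.P P.K) (k P i)) ∈ pts (k P i) (maxDomT Θ.ν.M₁ (Z P i) (k P i)) ∧
        (castSite z : Site (F.P P.K) (k P i)).shift ⟨0, h0 P⟩ ∈ pts (k P i) (maxDomT Θ.ν.M₁ (Z P i) (k P i)) ∧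
        (castSite z : Site (F.P P.K) (k P i)).shift ν' ∈ pts (k P i) (maxDomT Θ.ν.M₁ (Z P i) (k P i))) →
      (∀ P : B12.RunParams, (143 * (((((F.P P.K).d + 4 : ℕ) : ℝ)) ^ 2 / 4) ^ 2) * (Θ.ν.εreg * (F.P P.K).L ^ 2) ≤ 1 / 3) →
      (∀ P : B12.RunParams, 2 * (Θ.ν.εreg * (F.P P.K).L ^ 2) ≤ 2 * deltaSU (Fin 2) / ((((F.P P.K).d + 4) * (F.P P.K).L : ℕ) : ℝ) ^ 2) →
      (∀ P : B12.RunParams, (((((F.P P.K).d + 2) * (F.P P.K).L : ℕ) : ℝ) ^ 2 / 4) * (2 * (Θ.ν.εreg * (F.P P.K).L ^ 2)) < deltaSU (Fin 2)) →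
      (∀ (P : B12.RunParams) (i : ι P), ∀ x ∈ X P i, ∃ x₀ ∈ maxDomT Θ.ν.M₁ (Z P i) (k P i), ∃ w₀ : List (Letter (F.P P.K).d), w₀.length ≤ D₀ P i ∧ walkEnd x₀ w₀ = x) →
      (∀ (P : B12.RunParams) (i : ι P), D₀ P i + 3 * (∑ i' ∈ Finset.range (k P i + 1), ((F.P P.K).d * (((F.P P.K).L ^ i' - 1) / 2) + 1)) + ((3 * ((F.P P.K).d * (((F.P P.K).L - 1) / 2)) + 5) + 5) * (F.P P.K).L ^ k P i +
      (((F.P P.K).d + 4) * (F.P P.K).L + 2) * (∑ l ∈ Finset.Ico 0 (k P i), (F.P P.K).L ^ l) + 4 ≤ (F.P P.K).L ^ (k P i - 1) * Θ.ν.M₁) →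
      (∀ P : B12.RunParams, 4 * (F.P P.K).L ≤ Θ.ν.M₁) →
      (∀ (P : B12.RunParams) (i : ι P) (y : Site (F.P P.K) 0), B14.Eq22Determines.blockIter (k P i) y ∈ (castSite '' Set.Icc (lo P i - 1) (hi P i + 1) : Set (Site (F.P P.K) (k P i))) → y ∈ maxDomT Θ.ν.M₁ (Z P i) 1) →
      (∀ (P : B12.RunParams) (i : ι P), side (F.P P.K).L Θ.ν.M₁ (k P i) ∣ (F.P P.K).sitesPerDir 0) →
      (∀ (P : B12.RunParams) (i : ι P), 1 / 2 * (B₃ * (cE P + 1) * (F.P P.K).eta 1 ^ 2) ^ 2 * (Nat.card {q : Plaq (F.P P.K) 0 // q ∈ plaqsOf (maxDomT Θ.ν.M₁ (Z P i) 1)} : ℝ) ≤ cA P) →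
      (2 ≤ Θ.ν.M₁) →
      (0 < Θ.ν.εreg) →
      (Θ.ν.εreg ≤ a₀) →
      -- THE GUARD CAP `eG` and the cap-level datum tolerance `ρnG` with the head's rows at the cap (all upper bounds on `eG`, `ρnG`, `Θ.ν.εreg`)
      ∀ (eG ρnG : ∀ P : B12.RunParams, ι P → ℝ), (∀ (P : B12.RunParams) (i : ι P), 0 < eG P i) →
      (∀ (P : B12.RunParams) (i : ι P), 6 * ((((F.P P.K).d - 1 : ℕ)) : ℝ) * (F.P P.K).L ^ (k P i) * (2 * ((cE P + 1) * eG P i)) ≤ ρJ P i) →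
      (∀ (P : B12.RunParams) (i : ι P), 12 * ((((F.P P.K).d - 1 : ℕ)) : ℝ) * (F.P P.K).L * Θ.ν.εreg ≤ ρJ P i) →
      (∀ (P : B12.RunParams) (i : ι P), Θ.ν.εreg ≤ εW P i) →
      (∀ P : B12.RunParams, (143 * (((((F.P P.K).d + 4 : ℕ) : ℝ)) ^ 2 / 4) ^ 2) * (2 * ((F.P P.K).L : ℝ) ^ 2 * Θ.ν.εreg) ≤ 1 / 3) →
      (∀ P : B12.RunParams, 2 * (2 * ((F.P P.K).L : ℝ) ^ 2 * Θ.ν.εreg) ≤ 2 * deltaSU (Fin 2) / ((((F.P P.K).d + 4) * (F.P P.K).L : ℕ) : ℝ) ^ 2) →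
      (∀ (P : B12.RunParams) (i : ι P), (cE P + 1) * (2 * eG P i) ≤ a₁' ∧ B₃ * ((cE P + 1) * (2 * eG P i)) ≤ Θ.ν.εreg) →
      (Θ.ν.εreg < a₀) →
      (∀ (P : B12.RunParams) (i : ι P), 0 ≤ ρnG P i) →
      (∀ (P : B12.RunParams) (i : ι P), max (ρnG P i) ((((2 * (∑ i' ∈ Finset.range (k P i + 1), ((F.P P.K).d * (((F.P P.K).L ^ i' - 1) / 2) + 1)) + 1 +
                  (3 * ((F.P P.K).d * (((F.P P.K).L - 1) / 2)) + 5) * (F.P P.K).L ^ (k P i) : ℕ) : ℝ)) ^ 2 / 4 * (Θ.ν.εreg * (F.P P.K).eta 0 ^ 2) +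
                ((3 * ((F.P P.K).d * (((F.P P.K).L - 1) / 2)) + 5 : ℕ) : ℝ) * (6 * ((((((F.P P.K).d + 2) * (F.P P.K).L : ℕ) : ℝ) ^ 2 / 4) * (2 * (Θ.ν.εreg * (F.P P.K).L ^ 2))) * ∑ i' ∈ Finset.range (k P i), ((F.P P.K).L : ℝ) ^ i') + ((3 * ((F.P P.K).d * (((F.P P.K).L - 1) / 2)) + 5 : ℕ) : ℝ) * ρnG P i) ≤ δ₀ P i) →
      (∀ (P : B12.RunParams) (i : ι P), (((F.P P.K).d : ℝ) * n' P i + 1) * ((((F.P P.K).d - 1 : ℕ) : ℝ) * n' P i * ((12 * (F.P P.K).d * (n P i + 2) ^ 2 + 1) * eG P i) + 3 * (F.P P.K).d * (n P i + 2) ^ 2 * eG P i) ≤ ρnG P i) →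
      -- THE (J0′) RADIUS, announced BEFORE the data budget `eR`
      ∃ R : ∀ P : B12.RunParams, ι P → ℝ, (∀ P i, 0 < R P i) ∧
      ∀ (eR : ∀ P : B12.RunParams, ι P → ℝ), (∀ (P : B12.RunParams) (i : ι P), 0 < eR P i) → (∀ (P : B12.RunParams) (i : ι P), eR P i ≤ eG P i) →
      ∀ (ρn : ∀ P : B12.RunParams, ι P → ℝ),
      (∀ (P : B12.RunParams) (i : ι P), (((F.P P.K).d : ℝ) * n' P i + 1) * ((((F.P P.K).d - 1 : ℕ) : ℝ) * n' P i * ((12 * (F.P P.K).d * (n P i + 2) ^ 2 + 1) * eR P i)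
      + 3 * (F.P P.K).d * (n P i + 2) ^ 2 * eR P i) ≤ ρn P i) →
      ∀ (cJ : B12.RunParams → ℝ), (∀ P : B12.RunParams, 0 ≤ cJ P) →
      (∀ (P : B12.RunParams) (i : ι P), (cE P + 1) * (2 * eR P i) ≤ a₁' ∧ B₃ * ((cE P + 1) * (2 * eR P i)) ≤ Θ.ν.εreg) →
      (∀ (P : B12.RunParams) (i : ι P), 6 * ((((F.P P.K).d - 1 : ℕ)) : ℝ) * (F.P P.K).L * (2 * B₃ * (cE P + 1) * eR P i) ≤ ρ5 P i) →
      (∀ (P : B12.RunParams) (i : ι P), 6 * ((((F.P P.K).d - 1 : ℕ)) : ℝ) * (F.P P.K).L * (2 * B₃ * (cE P + 1) * eR P i) ≤ ρ6 P i) →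
      (∀ (P : B12.RunParams) (i : ι P), 2 * cA P * eR P i / R P i + 2 * ((Nat.card {q : Plaq (F.P P.K) 0 // q ∈ plaqsOf (maxDomT Θ.ν.M₁ (Z P i) 1)} : ℝ) * (1 + 8 * (4 * 𝓐₁) ^ 4)) / (R P i * eR P i) ≤ cJ P) →

    ∀ δ : ∀ P : B12.RunParams, ι P → ℝ, (∀ P i, 0 < δ P i) →
      -- the endpoint's EXPLICIT THRESHOLD per run (every quantity a displayed binder or a count of the run's instance — no `∃ δ₀`), then its TOLERANCE rows at `δ P i`
      (∀ (P : B12.RunParams) (i : ι P), δ P i ≤ min (min (min (ρ P i) (ρτ P i) / 2)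
        (min 1 (1 / 2 / (2 * (3 * (Kb P i : ℝ) ^ 2 + 2 * (Kb P i : ℝ) ^ 4)) /
          (max ((32 * (((F.P P.K).d : ℝ) - 1) + 8 * (((F.P P.K).d : ℝ) - 1) + (2 * (((F.P P.K).d : ℝ) - 1) * B₁ P i * (((∑ j ∈ Finset.range (k P i + 1), (2 * (F.P P.K).d) ^ j : ℕ) : ℝ) * M₂ P i))) * (12 * (4 * 𝓐₁) / R P i * Real.sqrt (Nat.card {b : PBond (F.P P.K) 0 // b ∈ {b : PBond (F.P P.K) 0 | b.src ∈ maxDomT Θ.ν.M₁ (Z P i) 1 ∨ b.tgt ∈ maxDomT Θ.ν.M₁ (Z P i) 1}})) ^ 2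
            + (8 * (((F.P P.K).d : ℝ) + 1) * (2 * (Kτ P i + 1)) + 8 * ((F.P P.K).d : ℝ) * (((box (fun κ => (hi P i κ - lo P i κ + 1).toNat + 3) (fun κ => lo P i κ - 2)).image (fun z => (castSite z : Site (F.P P.K) (k P i)))).card : ℝ) * (C P i * (12 * (4 * 𝓐₁) / R P i * Real.sqrt (Nat.card {b : PBond (F.P P.K) 0 // b ∈ {b : PBond (F.P P.K) 0 | b.src ∈ maxDomT Θ.ν.M₁ (Z P i) 1 ∨ b.tgt ∈ maxDomT Θ.ν.M₁ (Z P i) 1}}))) ^ 2)) 0 + 1)))) (εH P i)) →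
      ∀ (hfloor : ∀ (P : B12.RunParams) (i : ι P), ((((4 * (F.P P.K).d + (3 * ((F.P P.K).d * (((F.P P.K).L - 1) / 2)) + 5) + 3 : ℕ) : ℝ)) ^ 2 * ((F.P P.K).L : ℝ) ^ 2 / 4 + ((3 * ((F.P P.K).d * (((F.P P.K).L - 1) / 2)) + 5 : ℕ) : ℝ) * (24 * (((((F.P P.K).d + 2) * (F.P P.K).L : ℕ) : ℝ) ^ 2 / 4))) * (2 * B₃ * (cE P + 1) * eR P i) + ((3 * ((F.P P.K).d * (((F.P P.K).L - 1) / 2)) + 5 : ℕ) : ℝ) * ρn P i ≤ δ P i),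
      ∃ areg : ∀ P : B12.RunParams, ι P → ℝ, (∀ P i, 0 < areg P i) ∧
        ∀ P : B12.RunParams, lam.kSel P < P.K →
          B15Leaf (WOfRecord₁₃ F 2 (Θ.liveRepin₁₃ F 2)
            { lam with LF := fun P => lfVarOn su2Chart fun i => InstOn.stdB (Node00.bgMSCoPOfRecordB F 2 Θ.ν P.K (k P i) (maxDomT Θ.ν.M₁ (Z P i))) Θ.ν.M₁ lamDatumP (Z P i) (Λ P i) (k P i) (M P i) (areg P i) (anExt (pts (k P i) (Λ P i)) (T P i) (fun177stdB (Node00.bgMSCoPOfRecordB F 2 Θ.ν P.K (k P i) (maxDomT Θ.ν.M₁ (Z P i))) Θ.ν.M₁ lamDatumP (Z P i) (k P i)) (ext P i) (min (1 / 2) (min (R P i / 8) (γ₈ P / (M P i) ^ 5 * (R P i / 2) ^ 2 / (48 * (4 * ((Nat.card {q : Plaq (F.P P.K) 0 // q ∈ plaqsOf (maxDomT Θ.ν.M₁ (Z P i) 1)} : ℝ) * (1 + 8 * (4 * 𝓐₁) ^ 4)) / R P i + 1)))))) } P)) := by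
  -- §A  the thresholds from the head of record at `ν₀`, per instance
  obtain ⟨cK, c₀K, c₁K, B₃, a₀, a₁', hB₃2, ha₀0, ha₁0, H8⟩ := exists_thm1LetterT_atLength_lamDatum_pTop_inhabited F
  refine ⟨cK, c₀K, c₁K, B₃, a₀, a₁', hB₃2, ha₀0, ha₁0, fun hgrid h15EU => ?_⟩
  have hB₃ : 0 < B₃ := by
    have hL3 : (3 : ℝ) ≤ ((F.P 0).L : ℝ) := by exact_mod_cast T4ReflectionCone.three_le_L (F.P 0)
    have hLF : ((F.P 0).L : ℝ) = (F.L : ℝ) := by rfl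
    nlinarith [hB₃2, hL3, hLF]
  have hk1' : ∀ (P : B12.RunParams) (i : ι P), 1 ≤ k P i := fun P i => Nat.succ_le_of_lt (hk0 P i)
  choose ρJ εW hρJ hεW δ₀ hδ₀ hbody using fun (P : B12.RunParams) (i : ι P) =>
    exists_R_hMinRow_of_thm1LettersAtLength_alongOrbit_onZ_ofRecord (F := F) ν₀ P.K (hd3 P) (Z P i) (hk1 P i) (hk1' P i) (hdiv₀ P i) (hfloor₀ P) (hZblk P i)
      (hkc P i) (hc P i) (hMrad₀ P) (hM₁₀ P) (H8 ν₀ P.K (k P i) (hgrid P i).1 (hgrid P i).2.1 (hgrid P i).2.2 (hdiv₀ P i))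
      (thm1LetterEU_atLength_of_variationalThm1EUSepCoP7MGB h15EU ν₀ P.K (k P i) (hk0 P i) (hadm₀ P i))
  -- §A′ the four letter families from the hypothesis-free uniform producers, per run (constants = functions of `(P.K, k P)`)
  have hkle : ∀ (P : B12.RunParams) (i : ι P), k P i ≤ (F.P P.K).m + (F.P P.K).K := fun P i => Nat.le_of_succ_le (hk1 P i)
  choose C ρ Kτ ρτ ρ5 hC hρ hKτ hρτ hρ5 hhalf using fun P : B12.RunParams => exists_hWD_chartHalf_of_class_uniform_rowl1_family (F := F) P.K (h0 P) (k P) (hk0 P) (hkle P)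
  choose εH hεH B₁ hB1 hrow using fun P : B12.RunParams => exists_rowPreimageProxiesLetter_family_uniformB_lamBondsSeq (F := F) P.K (k P) (hk1 P)
  choose ρ6 M₂ hρ6 hM₂0 hsbU hcurv using fun P : B12.RunParams => exists_curvatureLetters_family (F := F) P.K (k P)
  refine ⟨ρJ, εW, δ₀, hρJ, hεW, hδ₀, C, ρ, Kτ, ρτ, ρ5, εH, B₁, ρ6, M₂, hC, hρ, hKτ, hρτ, hρ5, hεH, hB1, hρ6, hM₂0, ?_⟩
  intro Θ lam hν₀ hres hpin hmassLive h180 h189 hΩw hα3 hα2 haN hXΩ hfit hM4 hZ1 hdiv hcA hM2 hεreg ha₀ eG ρnG heG hρJ1 hρJ2 hεWr hα3h hα2h haG ha₀s hρnG0 hT hnormG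
  have hM₁ : ν₀.M₁ = Θ.ν.M₁ := by rw [← hν₀]
  -- the (8)-letter at `ν₀` per `(P, i)` (β's bridge, guard row `hadm₀`); read at `Θ.ν` below by `rw [← hν₀]` (the letter reads `ν` through `M₁` only)
  have h8₀ := fun (P : B12.RunParams) (i : ι P) => H8 ν₀ P.K (k P i) (hgrid P i).1 (hgrid P i).2.1 (hgrid P i).2.2 (hdiv₀ P i)
  -- §B  the radius at the cap, per instance
  choose R hR hMinG using fun (P : B12.RunParams) (i : ι P) =>
    hbody P i (Λ P i) (lo P i) (hi P i) (eG P i) (heG P i) (n P i) (hn P i) (hN5 P i) (hlohi P i) (hbox P i) (hZ P i)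
      (LO P i) (HI P i) (n' P i) (hLO P i) (hHI P i) (hn' P i) (hn'N P i) (hR' P i) (hscope P i) (hcE P i) (hρJ1 P i) (ext P i) (hext P i)
      h𝓐₁ Θ.ν.εreg hεreg (hρJ2 P i) (hεWr P i) (hα3h P) (hα2h P) (haG P i).1 (haG P i).2 ha₀s le_rfl (hρnG0 P i) (hT P i) (hnormG P i)
  refine ⟨R, hR, ?_⟩
  intro eR heR heRG ρn hρn cJ hcJ heRa hερ hερ6 hcJ' δ hδ hδle hfloor
  -- §C  (J0′) at the data budget `eR ≤ eG` by RESTRICTING the guard; numerics pinned to `Θ.ν`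
  have hMin : ∀ (P : B12.RunParams) (i : ι P) (Vk : GaugeField (F.P P.K) (k P i) SU2), PlaqSmallOn (plaqsInside (pts (k P i) (Z P i ∩ (Λ P i)ᶜ))) (eR P i) Vk →
      ∃ Ũ : VecField (F.P P.K) (k P i) (EuclideanSpace ℂ (Fin 3)) × VecField (F.P P.K) (k P i) (EuclideanSpace ℂ (Fin 3)) →
          PBond (F.P P.K) 0 → Matrix (Fin 2) (Fin 2) ℂ,
        (∀ b a c, DifferentiableOn ℂ (fun z => Ũ z b a c) (ball 0 (R P i))) ∧
        (∀ z ∈ ball (0 : VecField (F.P P.K) (k P i) (EuclideanSpace ℂ (Fin 3)) × VecField (F.P P.K) (k P i) (EuclideanSpace ℂ (Fin 3))) (R P i),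
          ∀ b a c, ‖Ũ z b a c‖ ≤ 4 * 𝓐₁) ∧
        ∀ p B' : VecField (F.P P.K) (k P i) E3, ‖p‖ < R P i → ‖B'‖ < R P i → ∃ U' : GaugeField (F.P P.K) 0 SU2,
          (∀ b, Ũ (cplxVec p, cplxVec B') b = ((U' b : SU2) : Matrix (Fin 2) (Fin 2) ℂ)) ∧
            IsMinimizerB (Node00.avOfRecord F 2 P.K) (Node00.regMSCoPOfRecord F 2 Θ.ν P.K (k P i) (maxDomT Θ.ν.M₁ (Z P i))) (lamBondsSeq (maxDomT Θ.ν.M₁ (Z P i)) (k P i))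
              (avgFamily (Node00.avOfRecord F 2 P.K) (qsstarGIter0 (k P i) (expMul su2Chart B' (ext P i (expMul su2Chart p Vk))))) U' := by
    intro P i Vk hV
    have h := hMinG P i Vk (plaqSmallOn_of_le (heRG P i) hV)
    rw [hν₀, hM₁] at h
    exact h
  -- §D  the two conversion letters DISCHARGED from the lane's kit ([15] (8) via `h15` + the datum's (7); dag-n12-c g31 ✓p746805)
  have hc1 : ∀ P : B12.RunParams, 0 ≤ cE P + 1 := fun P => by linarith [hcE0 P]
  have heRa1 : ∀ (P : B12.RunParams) (i : ι P), (cE P + 1) * eR P i ≤ a₁' := fun P i => by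
    have h := (heRa P i).1; nlinarith [mul_nonneg (hc1 P) (heR P i).le]
  have heRa2 : ∀ (P : B12.RunParams) (i : ι P), 2 * ((cE P + 1) * eR P i) ≤ a₁' := fun P i => by
    have h := (heRa P i).1; linarith [show (cE P + 1) * (2 * eR P i) = 2 * ((cE P + 1) * eR P i) by ring]
  have heν : ∀ (P : B12.RunParams) (i : ι P), 2 * B₃ * (cE P + 1) * eR P i ≤ Θ.ν.εreg := fun P i => by
    have h := (heRa P i).2; linarith [show B₃ * ((cE P + 1) * (2 * eR P i)) = 2 * B₃ * (cE P + 1) * eR P i by ring]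
  have he1 : ∀ (P : B12.RunParams) (i : ι P), B₃ * ((cE P + 1) * eR P i) ≤ 2 * B₃ * (cE P + 1) * eR P i := fun P i => by
    nlinarith [mul_nonneg hB₃.le (mul_nonneg (hc1 P) (heR P i).le)]
  have he2 : ∀ (P : B12.RunParams) (i : ι P), B₃ * (2 * ((cE P + 1) * eR P i)) ≤ 2 * B₃ * (cE P + 1) * eR P i := fun P i => le_of_eq (by ring)
  have hKa : ∀ (P : B12.RunParams) (i : ι P) (Vk : GaugeField (F.P P.K) (k P i) SU2), PlaqSmallOn (plaqsInside (pts (k P i) (Z P i ∩ (Λ P i)ᶜ))) (eR P i) Vk →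
      (∀ b ∈ (boxBonds (LO P i) (HI P i) : Set (PBond (F.P P.K) (k P i))), dist1 (ext P i Vk b) ≤ ρn P i) →
      ∀ U₀ : GaugeField (F.P P.K) 0 SU2,
        IsMinimizerB (Node00.avOfRecord F 2 P.K) (Node00.regMSCoPOfRecord F 2 Θ.ν P.K (k P i) (maxDomT Θ.ν.M₁ (Z P i))) (lamBondsSeq (maxDomT Θ.ν.M₁ (Z P i)) (k P i))
          (avgFamily (Node00.avOfRecord F 2 P.K) (qsstarGIter0 (k P i) (ext P i Vk))) U₀ →
        IsMinimizerB (Node00.avOfRecord F 2 P.K) (Node00.regMSCoPOfRecord F 2 {Θ.ν with εreg := 2 * B₃ * (cE P + 1) * eR P i} P.K (k P i) (maxDomT Θ.ν.M₁ (Z P i))) (lamBondsSeq (maxDomT Θ.ν.M₁ (Z P i)) (k P i))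
          (avgFamily (Node00.avOfRecord F 2 P.K) (qsstarGIter0 (k P i) (ext P i Vk))) U₀ :=
    fun P i Vk hg _ U₀ hU₀ =>
      (isMinimizerB_withEps_base_of_thm1AtLength Θ.ν P.K (hd3 P) (Z P i) (Λ P i) (hk0 P i) (hkle P i) (lo P i) (hi P i) (n P i) (hn P i) (hlohi P i)
        (hbox P i) (hZ P i) (boxRow3_of_boxRow5 (hlohi P i) (hN5 P i)) (ext P i) (hext P i) (hZblk P i) hM2 (hdiv P i) lamDatumP (fun Ω Ω' hΩ => lamBondsSeq_congr (hk0 P i) Ω Ω' hΩ) (hcE P i)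
        (by rw [← hν₀]; exact h8₀ P i) (2 * B₃ * (cE P + 1) * eR P i) (eR P i) Vk (heR P i) (heRa1 P i) (he1 P i) (heν P i) ha₀ hg U₀ hU₀).2
  have hKb : ∀ (P : B12.RunParams) (i : ι P) (Vk : GaugeField (F.P P.K) (k P i) SU2), PlaqSmallOn (plaqsInside (pts (k P i) (Z P i ∩ (Λ P i)ᶜ))) (eR P i) Vk →
      (∀ b ∈ (boxBonds (LO P i) (HI P i) : Set (PBond (F.P P.K) (k P i))), dist1 (ext P i Vk b) ≤ ρn P i) →
      ∃ r : ℝ, 0 < r ∧ ∀ Y : GaugeSlice (pts (k P i) (Λ P i)) (T P i) E3, ‖Y‖ < r → ∀ U : GaugeField (F.P P.K) 0 SU2,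
        IsMinimizerB (Node00.avOfRecord F 2 P.K) (Node00.regMSCoPOfRecord F 2 Θ.ν P.K (k P i) (maxDomT Θ.ν.M₁ (Z P i))) (lamBondsSeq (maxDomT Θ.ν.M₁ (Z P i)) (k P i))
          (avgFamily (Node00.avOfRecord F 2 P.K) (qsstarGIter0 (k P i) (expMul su2Chart (ιA (pts (k P i) (Λ P i)) (T P i) Y) (ext P i Vk)))) U →
        IsMinimizerB (Node00.avOfRecord F 2 P.K) (Node00.regMSCoPOfRecord F 2 {Θ.ν with εreg := 2 * B₃ * (cE P + 1) * eR P i} P.K (k P i) (maxDomT Θ.ν.M₁ (Z P i))) (lamBondsSeq (maxDomT Θ.ν.M₁ (Z P i)) (k P i))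
          (avgFamily (Node00.avOfRecord F 2 P.K) (qsstarGIter0 (k P i) (expMul su2Chart (ιA (pts (k P i) (Λ P i)) (T P i) Y) (ext P i Vk)))) U :=
    fun P i Vk hg _ => ⟨eR P i / 8, by have := heR P i; positivity, fun Y hY U hU =>
      (isMinimizerB_withEps_of_norm_lt_atLength Θ.ν P.K (hd3 P) (Z P i) (Λ P i) (hk0 P i) (hkle P i) (lo P i) (hi P i) (n P i) (hn P i) (hlohi P i)
        (hbox P i) (hZ P i) (boxRow3_of_boxRow5 (hlohi P i) (hN5 P i)) (ext P i) (hext P i) (hZblk P i) hM2 (hdiv P i) lamDatumP (fun Ω Ω' hΩ => lamBondsSeq_congr (hk0 P i) Ω Ω' hΩ) (hcE P i)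
        (by rw [← hν₀]; exact h8₀ P i) (heR P i) (heRa2 P i) (he2 P i) (heν P i) ha₀ Vk hg (T P i) Y hY U hU).2⟩
  exact exists_areg_pinLF_b15Leaf_WOfRecord₁₃_liveRepin₁₃_of_massLive_of_hasResiduals_of_thm1AtLength_atZSeqCoPRecord_windowDirectOfClassOnlyRowL1NearRadiusDatumScale Θ lam
    (hres := hres) (hpin := hpin) (hmassLive := hmassLive) (h180 := h180) (h189 := h189) (hd3 := hd3) (h0 := h0) (ι := ι) (B₃ := B₃) (a₀ := a₀) (a₁' := a₁') (Z := Z) (Λ := Λ) (k := k)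
    (M := M) (hk0 := hk0) (hk1 := hk1) (eR := eR) (heR := heR) (T := T) (lo := lo) (hi := hi) (n := n) (hn := hn) (hN := hN) (hbox := hbox) (hZ := hZ) (hTG0 := hTG0) (hN5 := hN5) (Kb := Kb)
    (hK1 := hK1) (hKn := hKn) (ext := ext) (hext := hext) (hlohi := hlohi) (LO := LO) (HI := HI) (hLO := hLO) (hHI := hHI) (n' := n') (hn' := hn') (hn'N := hn'N) (hR' := hR') (ρn := ρn)
    (hρn := hρn) (γ₈ := γ₈) (cJ := cJ) (bx := bx) (hγ := hγ) (hcJ := hcJ) (hbx := hbx) (hbxM := hbxM) (R := R) (𝓐₀ := fun _ _ => 4 * 𝓐₁) (hM := hM) (hR := hR)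
    (h𝓐₀ := fun _ _ => by positivity) (hMin := hMin) (hΩw := hΩw) (W := W) (hWbox := hWbox) (c := c) (hkc := hkc) (hc := hc) (hα3 := hα3) (hα2 := hα2) (haN := haN) (X := X) (D₀ := D₀)
    (hXΩ := hXΩ) (hfit := hfit) (hBox := hBox) (hWX := hWX) (hfeedsX := hfeedsX) (C := C) (ρ := ρ) (Kτ := Kτ) (ρτ := ρτ) (ρ5 := ρ5) (hρ := hρ) (hKτ := hKτ) (hρτ := hρτ) (hhalf := hhalf)
    (cE := cE) (cA := cA) (hcE0 := hcE0) (hcE := hcE) (heRa := heRa) (hM4 := hM4) (hερ := hερ) (εH := εH) (B₁ := B₁) (M₂ := M₂) (ρ6 := ρ6) (hB1 := hB1) (hM₂0 := hM₂0) (hHrow := fun P i Wd U₀ => hrow P Θ.ν hM2 (Z P) (hdiv P) i Wd U₀)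
    (hsbU := hsbU) (hcurv := hcurv) (hερ6 := hερ6) (hKa := hKa) (hKb := hKb) (hγle := hγle) (hZ1 := hZ1) (hZblk := hZblk) (hdiv := hdiv) (hcA := hcA) (hcJ' := hcJ') (hM2 := hM2)
    (hB₃ := hB₃) (hεreg := hεreg) (ha₀ := ha₀) (h15T := fun P i => by rw [← hν₀]; exact h8₀ P i)
    δ hδ hδle hfloor

end

end Summit.QuantumFields.YangMills.BalabanUVNodes.N12AtRecord13Prop1KnitThm1WindowDirectDatumScaleLettersDischargedAtLengthOfK0Stub1BOfRecord

end
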